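import Summits.Ventures.HSemireg.WedgeHankelRecurrenceGaussMarkovCorollaries

/-!
# Venture HSemireg — **STURM'S OSCILLATION THEOREM FOR THE JACOBI EIGENVECTORS**: for a positive recurrence, the eigenvector `(q_0(z_k), …, q_{m+1}(z_k))` of the Jacobi matrix at its
# `(k+1)`-th smallest eigenvalue `z_k` (the `k`-th zero of `q_{m+2}`, `k = 0, …, m+1`) has EXACTLY `m + 1 − k` sign changes — whatever signs are given to its vanishing entries; on the
# way, the Sturm count `#{sign changes of (q_0(ξ), …, q_n(ξ))} = #{zeros of q_n right of ξ}` is extended to points `ξ` where intermediate members vanish, and all `q_j` (`j ≤ m + 1`)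
# are shown positive at the largest zero of `q_{m+2}`

HONEST FRAMING. Part of the Lean index of the computation cell `pub-hsemireg` (seat p10 gen 44, Sunday typer «UNIFORM-IN-n»).  Real polynomials and finite counting only; no variety, no
cohomology theory, no sheaf, no Ext group and no semiregularity map is constructed here; nothing here says that HC / HC_CM / HC_AV holds; no Literature fact (unproved `Prop`) is declared or used.
Custodian versions as in `WedgeHankelSiegelIdeal` (1/3).
SOURCES (cited).  C. Sturm, *Mémoire sur les équations différentielles linéaires du second ordre*, J. Math. Pures Appl. 1 (1836) 106–186; F. R. Gantmacher, M. G. Krein, *Oscillation Matrices and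
Kernels and Small Vibrations of Mechanical Systems* (1950; AMS Chelsea 2002), Ch. II §1 Thm 6 (the `k`-th eigenvector of a Jacobi matrix has exactly `k − 1` sign changes) and the rule for
zero components; G. Szegő, *Orthogonal Polynomials*, Thm 3.3.4; J. H. Wilkinson, *The Algebraic Eigenvalue Problem* (1965) Ch. 5 §37–§38 (Sturm sequence property with zero members).
PROOF TYPED HERE.  Strong induction on `n` for the extended count: if `q_{n−1}(ξ) ≠ 0` the last comparison is N294's `card_filter_lt_eq_add_ite`; if `q_{n−1}(ξ) = 0` then `ξ` is a zero `w_{k₀}` of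
`q_{n−1}`, `q_{n−2}(ξ) q_n(ξ) = −b_{n−1} q_{n−2}(ξ)² < 0`, the two comparisons around the vanishing member contribute exactly `1` for any sign given to it, and the zero counts of `q_n` and
`q_{n−2}` right of `w_{k₀}` are `n − 1 − k₀` and `n − 2 − k₀` by interlacing.  The oscillation theorem is the count at `ξ = z_k` with `n = m + 1` (no common zeros), where the interlacing gives
`#{i : z_k < w_i} = m + 1 − k`.
DEDUP DISCLOSURE (`rg -n 'oscillation|sign_changes|eigenvector_sign|sturm_count' Summits/Ventures/HSemireg Literature`, 2026-09-03): N294 `sturm_count_recurrence` is the count under the hypothesis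
that NO `q_k(ξ)` vanishes (`k ≤ n`); `Literature.Algebra.Polynomial.SturmTheorem` treats Sturm chains `P, P', …` (private API).  The extension to vanishing intermediate members, the counting
lemmas at a zero, the positivity at the top zero and the eigenvector statement are new.  The 9 names below: 0 hits tree-wide.

WHAT IS IN THE TREE.  N279 `recurrence_zeros_interlace`; N294 `card_filter_range_succ`, `card_filter_lt_eq_add_ite`, `strictMono_eq_of_prod_X_sub_C_eq`; N274 `recurrence_no_common_root`;
N293 `jacobi_eigenvector_of_eval_eq_zero` (the vector `(q_j(z))_j` IS the eigenvector); Mathlib `Fin.card_filter_val_lt`.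
THIS FILE (namespace `Summit.Ventures.HSemireg.Wedge.HankelOuter` continued; CHAINED on N321 (import only), N274, N279, N294; 0 definitions):
* §1087 `card_univ_filter_val_ge` (`#{i : Fin n | k ≤ i} = n − k`), `recurrence_zeros_below_of_prod` (zeros of `q_m` interlacing given zeros of `q_{m+1}`, every `m`), `recurrence_link_neg`
  (`q_{k+1}(ξ) = 0 ⇒ q_k(ξ) q_{k+2}(ξ) < 0`), `ite_add_ite_eq_one_of_mul_neg'` (two comparisons around a member of any sign between two opposite ones give `1`), `mul_neg_iff_of_same_signs`,
  `card_filter_outer_gt_inner_zero` (`#{i : w_{k₀} < z_i} = m + 1 − k₀`), `card_filter_inner_gt_outer_zero` (`#{i : z_k < w_i} = m + 1 − k`), **`sturm_count_recurrence_general`** (the count with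
  vanishing intermediate members, for any signs given to them), **`jacobi_eigenvector_sign_changes`** (exactly `m + 1 − k` sign changes at `z_k`), `jacobi_eigenvector_sign_changes_of_ne`
  (N294's vocabulary when nothing vanishes), **`recurrence_eval_pos_at_top_zero`** (`q_j(z_{m+1}) > 0` for all `j ≤ m + 1`).
CAVEATS.  Positive recurrences (`b_j > 0`); «sign changes» is the count `#{j < m+1 : g_j g_{j+1} < 0}` for an arbitrary nowhere-zero `g` agreeing in sign with the non-zero entries.
Nothing Ext-side.  New names only.
-/

open Module Polynomial
open scoped Matrix Polynomial

namespace Summit.Ventures.HSemireg.Wedge.HankelOuter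

/-! ## §1087. Sturm's oscillation theorem for the Jacobi eigenvectors -/

/-- `#{i : Fin n | k ≤ i} = n − k` for `k ≤ n`. [bookkeeping; this file, §1087] -/
theorem card_univ_filter_val_ge {n k : ℕ} (hk : k ≤ n) : (Finset.univ.filter (fun i : Fin n => k ≤ (i : ℕ))).card = n - k := by
  have h := Finset.card_filter_add_card_filter_not (s := (Finset.univ : Finset (Fin n))) (fun i : Fin n => (i : ℕ) < k)
  rw [Finset.card_univ, Fintype.card_fin, Fin.card_filter_val_lt, min_eq_right hk] at h
  have h' : (Finset.univ.filter (fun i : Fin n => ¬ (i : ℕ) < k)) = Finset.univ.filter (fun i : Fin n => k ≤ (i : ℕ)) :=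
    Finset.filter_congr fun i _ => not_lt
  rw [h'] at h
  omega

/-- **The zeros of `q_m` below those of `q_{m+1}`, every `m`**: given the zeros `w` of `q_{m+1}`, the zeros `u` of `q_m` exist, are simple, and interlace `w` (`m = 0`: vacuous).
[N279 repackaged; this file, §1087] -/
theorem recurrence_zeros_below_of_prod {q : ℕ → ℝ[X]} {a b : ℕ → ℝ} (hq0 : q 0 = 1) (hq1 : q 1 = Polynomial.X - C (a 0))
    (hrec : ∀ n, q (n + 2) = (Polynomial.X - C (a (n + 1))) * q (n + 1) - C (b (n + 1)) * q n) (hb : ∀ j, 0 < b j) :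
    ∀ (m : ℕ) {w : Fin (m + 1) → ℝ}, StrictMono w → q (m + 1) = ∏ k, (Polynomial.X - C (w k)) →
      ∃ u : Fin m → ℝ, StrictMono u ∧ q m = ∏ i, (Polynomial.X - C (u i)) ∧ ∀ i : Fin m, w i.castSucc < u i ∧ u i < w i.succ := by
  intro m
  rcases m with _ | m
  · intro w _ _
    exact ⟨Fin.elim0, fun i => Fin.elim0 i, by rw [hq0, Fin.prod_univ_zero], fun i => Fin.elim0 i⟩
  · intro w hw hwq
    obtain ⟨u, y, hu, hy, huq, hyq, hint⟩ := recurrence_zeros_interlace hq0 hq1 hrec hb m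
    have hyw : y = w := strictMono_eq_of_prod_X_sub_C_eq hy hw (hyq.symm.trans hwq)
    subst hyw
    exact ⟨u, hu, huq, hint⟩

/-- **The link property: `q_{k+1}(ξ) = 0 ⇒ q_k(ξ) · q_{k+2}(ξ) < 0`** (`q_{k+2}(ξ) = −b_{k+1} q_k(ξ)` and no common zero). [Szegő Thm 3.3.4 proof; this file, §1087] -/
theorem recurrence_link_neg {q : ℕ → ℝ[X]} {a b : ℕ → ℝ} (hq0 : q 0 = 1) (hq1 : q 1 = Polynomial.X - C (a 0))
    (hrec : ∀ n, q (n + 2) = (Polynomial.X - C (a (n + 1))) * q (n + 1) - C (b (n + 1)) * q n) (hb : ∀ j, 0 < b j)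
    (k : ℕ) {ξ : ℝ} (hk : (q (k + 1)).eval ξ = 0) : (q k).eval ξ * (q (k + 2)).eval ξ < 0 := by
  have hqk : (q k).eval ξ ≠ 0 := fun h0 => recurrence_no_common_root hq0 hq1 hrec hb k h0 hk
  have h2 : (q (k + 2)).eval ξ = -(b (k + 1) * (q k).eval ξ) := by
    rw [hrec k, eval_sub, eval_mul, eval_sub, eval_X, eval_C, eval_mul, eval_C, hk, mul_zero, zero_sub]
  rw [h2, mul_neg, neg_lt_zero, mul_left_comm]
  exact mul_pos (hb _) (mul_self_pos.2 hqk)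

/-- Around a member `m` of ANY non-zero sign placed between two members of opposite signs, exactly one of the two comparisons is a sign change. [BPR Notation 2.32 remark; this file, §1087] -/
theorem ite_add_ite_eq_one_of_mul_neg' {a c m : ℝ} (hac : a * c < 0) (hm : m ≠ 0) :
    (if a * m < 0 then 1 else 0) + (if m * c < 0 then 1 else 0) = 1 := by
  rcases mul_neg_iff.1 hac with ⟨ha, hc⟩ | ⟨ha, hc⟩ <;> rcases lt_or_gt_of_ne hm with hm | hm
  · rw [if_pos (mul_neg_of_pos_of_neg ha hm), if_neg (not_lt.2 (mul_pos_of_neg_of_neg hm hc).le)]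
  · rw [if_neg (not_lt.2 (mul_pos ha hm).le), if_pos (mul_neg_of_pos_of_neg hm hc)]
  · rw [if_neg (not_lt.2 (mul_pos_of_neg_of_neg ha hm).le), if_pos (mul_neg_of_neg_of_pos hm hc)]
  · rw [if_pos (mul_neg_of_neg_of_pos ha hm), if_neg (not_lt.2 (mul_pos hm hc).le)]

/-- Two pairs with pairwise equal signs have products of the same sign. [this file, §1087] -/
theorem mul_neg_iff_of_same_signs {a a' c c' : ℝ} (ha : 0 < a * a') (hc : 0 < c * c') : a' * c' < 0 ↔ a * c < 0 := by
  have h : 0 < (a * c) * (a' * c') := by rw [show (a * c) * (a' * c') = (a * a') * (c * c') by ring]; exact mul_pos ha hc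
  rcases pos_and_pos_or_neg_and_neg_of_mul_pos h with ⟨h1, h2⟩ | ⟨h1, h2⟩
  · exact ⟨fun h' => absurd h' (not_lt.2 h2.le), fun h' => absurd h' (not_lt.2 h1.le)⟩
  · exact ⟨fun _ => h1, fun _ => h2⟩

/-- **Counting at an inner zero**: for interlacing `z_0 < w_0 < z_1 < ⋯ < w_m < z_{m+1}`, the number of `z_i` to the right of `w_{k₀}` is `m + 1 − k₀`. [this file, §1087] -/
theorem card_filter_outer_gt_inner_zero {m : ℕ} {z : Fin (m + 2) → ℝ} {w : Fin (m + 1) → ℝ} (hz : StrictMono z)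
    (hint : ∀ k : Fin (m + 1), z k.castSucc < w k ∧ w k < z k.succ) (k₀ : Fin (m + 1)) :
    (Finset.univ.filter (fun i : Fin (m + 2) => w k₀ < z i)).card = m + 1 - k₀ := by
  have h : Finset.univ.filter (fun i : Fin (m + 2) => w k₀ < z i) = Finset.univ.filter (fun i : Fin (m + 2) => (k₀ : ℕ) + 1 ≤ (i : ℕ)) := by
    refine Finset.filter_congr fun i _ => ⟨fun h => ?_, fun h => ?_⟩
    · by_contra hlt
      have hle : i ≤ k₀.castSucc := by rw [Fin.le_def, Fin.val_castSucc]; omega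
      exact absurd ((hz.monotone hle).trans_lt (hint k₀).1) (not_lt.2 h.le)
    · have hle : k₀.succ ≤ i := by rw [Fin.le_def, Fin.val_succ]; exact h
      exact (hint k₀).2.trans_le (hz.monotone hle)
  rw [h, card_univ_filter_val_ge (by omega)]
  omega

/-- **Counting at an outer zero**: for interlacing `z_0 < w_0 < z_1 < ⋯ < w_{m−1} < z_m`, the number of `w_i` to the right of `z_k` is `m − k`. [this file, §1087] -/
theorem card_filter_inner_gt_outer_zero {m : ℕ} {z : Fin (m + 1) → ℝ} {w : Fin m → ℝ} (hz : StrictMono z)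
    (hint : ∀ i : Fin m, z i.castSucc < w i ∧ w i < z i.succ) (k : Fin (m + 1)) :
    (Finset.univ.filter (fun i : Fin m => z k < w i)).card = m - k := by
  have h : Finset.univ.filter (fun i : Fin m => z k < w i) = Finset.univ.filter (fun i : Fin m => (k : ℕ) ≤ (i : ℕ)) := by
    refine Finset.filter_congr fun i _ => ⟨fun h => ?_, fun h => ?_⟩
    · by_contra hlt
      have hle : i.succ ≤ k := by rw [Fin.le_def, Fin.val_succ]; omega
      exact absurd ((hint i).2.trans_le (hz.monotone hle)) (not_lt.2 h.le)
    · have hle : k ≤ i.castSucc := by rw [Fin.le_def, Fin.val_castSucc]; exact h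
      exact (hz.monotone hle).trans_lt (hint i).1
  rw [h, card_univ_filter_val_ge (by omega)]

/-- **THE STURM COUNT WITH VANISHING INTERMEDIATE MEMBERS**: for a positive recurrence, `q_n = ∏ (X − z_i)` with `z` increasing, `q_n(ξ) ≠ 0`, and ANY nowhere-zero `g_0, …, g_n` agreeing in
sign with the non-zero `q_k(ξ)`, the number of sign changes `#{k < n : g_k g_{k+1} < 0}` equals the number of zeros of `q_n` to the right of `ξ`. [Szegő Thm 3.3.4; Wilkinson Ch. 5 §38;
this file, §1087] -/
theorem sturm_count_recurrence_general {q : ℕ → ℝ[X]} {a b : ℕ → ℝ} (hq0 : q 0 = 1) (hq1 : q 1 = Polynomial.X - C (a 0))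
    (hrec : ∀ n, q (n + 2) = (Polynomial.X - C (a (n + 1))) * q (n + 1) - C (b (n + 1)) * q n) (hb : ∀ j, 0 < b j) :
    ∀ (n : ℕ) {z : Fin n → ℝ}, StrictMono z → q n = ∏ i, (Polynomial.X - C (z i)) → ∀ {ξ : ℝ}, (q n).eval ξ ≠ 0 →
      ∀ {g : ℕ → ℝ}, (∀ k, k ≤ n → g k ≠ 0) → (∀ k, k ≤ n → (q k).eval ξ ≠ 0 → 0 < (q k).eval ξ * g k) →
        ((Finset.range n).filter (fun k => g k * g (k + 1) < 0)).card = (Finset.univ.filter (fun i : Fin n => ξ < z i)).card := by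
  -- root form of the values and of «not a zero»
  have heval : ∀ {N k : ℕ} {y : Fin N → ℝ} (ξ : ℝ), q k = ∏ i, (Polynomial.X - C (y i)) → (q k).eval ξ = ∏ i, (ξ - y i) := by
    intro N k y ξ hk
    rw [hk, eval_prod]
    exact Finset.prod_congr rfl fun i _ => by rw [eval_sub, eval_X, eval_C]
  have hnz : ∀ {N k : ℕ} {y : Fin N → ℝ} {ξ : ℝ}, q k = ∏ i, (Polynomial.X - C (y i)) → (q k).eval ξ ≠ 0 → ∀ i, ξ ≠ y i := by
    intro N k y ξ hk hξ i hi
    apply hξ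
    rw [heval ξ hk]
    exact Finset.prod_eq_zero (Finset.mem_univ i) (by rw [hi, sub_self])
  intro n
  induction n using Nat.strong_induction_on with
  | _ n ih =>
  intro z hz hzq ξ hξ g hg hsgn
  rcases n with _ | n
  · simp
  rcases n with _ | m
  · -- `n = 1`: `g_0 > 0` and `sign g_1 = sign (ξ − z_0)`
    rw [card_filter_range_succ, Finset.range_zero, Finset.filter_empty, Finset.card_empty, zero_add, Finset.card_filter, Fin.sum_univ_one]
    have hg0 : 0 < g 0 := by
      have h := hsgn 0 (by omega) (by rw [hq0, eval_one]; exact one_ne_zero)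
      rwa [hq0, eval_one, one_mul] at h
    have hg1 : 0 < (ξ - z 0) * g 1 := by
      have h := hsgn 1 le_rfl hξ
      rwa [heval ξ hzq, Fin.prod_univ_one] at h
    have hξ0 : ξ ≠ z 0 := hnz hzq hξ 0
    by_cases h : ξ < z 0
    · have hg1' : g 1 < 0 := by
        rcases pos_and_pos_or_neg_and_neg_of_mul_pos hg1 with ⟨h1, -⟩ | ⟨-, h2⟩
        · exact absurd h1 (not_lt.2 (sub_neg.2 h).le)
        · exact h2
      rw [if_pos (mul_neg_of_pos_of_neg hg0 hg1'), if_pos h]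
    · have hl : 0 < ξ - z 0 := sub_pos.2 (lt_of_le_of_ne (not_lt.1 h) (Ne.symm hξ0))
      have hg1' : 0 < g 1 := (mul_pos_iff_of_pos_left hl).1 hg1
      rw [if_neg (not_lt.2 (mul_pos hg0 hg1').le), if_neg h]
  · -- `n = m + 2`: the zeros `w` of `q_{m+1}` interlace `z`
    obtain ⟨w, hw, hwq, hint⟩ := recurrence_zeros_below_of_prod hq0 hq1 hrec hb (m + 1) hz hzq
    have hξz : ∀ i, ξ ≠ z i := hnz hzq hξ
    rw [card_filter_range_succ]
    by_cases hq1ξ : (q (m + 1)).eval ξ = 0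
    · -- `ξ` is a zero `w k₀` of `q_{m+1}`; around the vanishing member the two comparisons give `1`
      obtain ⟨k₀, hk₀⟩ : ∃ k₀, ξ = w k₀ := by
        by_contra hne
        push Not at hne
        refine (show (q (m + 1)).eval ξ ≠ 0 from ?_) hq1ξ
        rw [heval ξ hwq]
        exact Finset.prod_ne_zero_iff.2 fun i _ => sub_ne_zero.2 (hne i)
      obtain ⟨u, hu, huq, hintu⟩ := recurrence_zeros_below_of_prod hq0 hq1 hrec hb m hw hwq
      have hqm : (q m).eval ξ ≠ 0 := fun h0 => recurrence_no_common_root hq0 hq1 hrec hb m h0 hq1ξ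
      have hneg : g m * g (m + 2) < 0 :=
        (mul_neg_iff_of_same_signs (hsgn m (by omega) hqm) (hsgn (m + 2) le_rfl hξ)).2 (recurrence_link_neg hq0 hq1 hrec hb m hq1ξ)
      rw [card_filter_range_succ, ih m (by omega) hu huq hqm (fun k hk => hg k (by omega)) (fun k hk => hsgn k (by omega)), add_assoc,
        ite_add_ite_eq_one_of_mul_neg' hneg (hg (m + 1) (by omega)), hk₀, card_filter_inner_gt_outer_zero hw hintu k₀,
        card_filter_outer_gt_inner_zero hz hint k₀]
      have := k₀.is_lt
      omega
    · -- no member vanishes at the top: N294's step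
      have hξw : ∀ i, ξ ≠ w i := hnz hwq hq1ξ
      rw [ih (m + 1) (by omega) hw hwq hq1ξ (fun k hk => hg k (by omega)) (fun k hk => hsgn k (by omega)),
        card_filter_lt_eq_add_ite hint hξz hξw, ← heval ξ hwq, ← heval ξ hzq]
      congr 1
      have hs1 := hsgn (m + 1) (by omega) hq1ξ
      have hs2 := hsgn (m + 2) le_rfl hξ
      by_cases hc : (q (m + 1)).eval ξ * (q (m + 2)).eval ξ < 0
      · rw [if_pos hc, if_pos ((mul_neg_iff_of_same_signs hs1 hs2).2 hc)]
      · rw [if_neg hc, if_neg (fun h => hc ((mul_neg_iff_of_same_signs hs1 hs2).1 h))]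

/-- **STURM'S OSCILLATION THEOREM FOR THE JACOBI EIGENVECTORS**: let `z_0 < ⋯ < z_{m+1}` be the zeros of `q_{m+2}` (the eigenvalues of the `(m+2) × (m+2)` Jacobi matrix, N293, with eigenvectors
`(q_j(z_k))_{j ≤ m+1}`).  For ANY nowhere-zero `g` agreeing in sign with the non-zero entries `q_j(z_k)`, the number of sign changes `#{j ≤ m : g_j g_{j+1} < 0}` is EXACTLY `m + 1 − k`.
[Gantmacher–Krein Ch. II §1 Thm 6; Sturm 1836; this file, §1087] -/
theorem jacobi_eigenvector_sign_changes {q : ℕ → ℝ[X]} {a b : ℕ → ℝ} (hq0 : q 0 = 1) (hq1 : q 1 = Polynomial.X - C (a 0))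
    (hrec : ∀ n, q (n + 2) = (Polynomial.X - C (a (n + 1))) * q (n + 1) - C (b (n + 1)) * q n) (hb : ∀ j, 0 < b j)
    {m : ℕ} {z : Fin (m + 2) → ℝ} (hz : StrictMono z) (hzq : q (m + 2) = ∏ k, (Polynomial.X - C (z k))) (k : Fin (m + 2))
    {g : ℕ → ℝ} (hg : ∀ j, j ≤ m + 1 → g j ≠ 0) (hsgn : ∀ j, j ≤ m + 1 → (q j).eval (z k) ≠ 0 → 0 < (q j).eval (z k) * g j) :
    ((Finset.range (m + 1)).filter (fun j => g j * g (j + 1) < 0)).card = m + 1 - k := by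
  obtain ⟨w, hw, hwq, hint⟩ := recurrence_zeros_below_of_prod hq0 hq1 hrec hb (m + 1) hz hzq
  have hzk : (q (m + 2)).eval (z k) = 0 := by
    rw [hzq, eval_prod]
    exact Finset.prod_eq_zero (Finset.mem_univ k) (by rw [eval_sub, eval_X, eval_C, sub_self])
  have hξ : (q (m + 1)).eval (z k) ≠ 0 := fun h => recurrence_no_common_root hq0 hq1 hrec hb (m + 1) h hzk
  rw [sturm_count_recurrence_general hq0 hq1 hrec hb (m + 1) hw hwq hξ hg hsgn]
  exact card_filter_inner_gt_outer_zero hz hint k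

/-- **The same in N294's vocabulary when no entry vanishes**: `#{j ≤ m : q_j(z_k) q_{j+1}(z_k) < 0} = m + 1 − k`, i.e. `Var(q_0(z_k), …, q_{m+1}(z_k)) = m + 1 − k`.
[Gantmacher–Krein Ch. II §1 Thm 6; this file, §1087] -/
theorem jacobi_eigenvector_sign_changes_of_ne {q : ℕ → ℝ[X]} {a b : ℕ → ℝ} (hq0 : q 0 = 1) (hq1 : q 1 = Polynomial.X - C (a 0))
    (hrec : ∀ n, q (n + 2) = (Polynomial.X - C (a (n + 1))) * q (n + 1) - C (b (n + 1)) * q n) (hb : ∀ j, 0 < b j)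
    {m : ℕ} {z : Fin (m + 2) → ℝ} (hz : StrictMono z) (hzq : q (m + 2) = ∏ k, (Polynomial.X - C (z k))) (k : Fin (m + 2))
    (hne : ∀ j, j ≤ m + 1 → (q j).eval (z k) ≠ 0) :
    ((Finset.range (m + 1)).filter (fun j => (q j).eval (z k) * (q (j + 1)).eval (z k) < 0)).card = m + 1 - k ∧
      Literature.Algebra.Polynomial.chainVar q (m + 1) (z k) = m + 1 - k := by
  have h := jacobi_eigenvector_sign_changes hq0 hq1 hrec hb hz hzq k (g := fun j => (q j).eval (z k)) hne (fun j _ h0 => mul_self_pos.2 h0)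
  exact ⟨h, by rw [chainVar_recurrence_eq_card q (m + 1) hne]; exact h⟩

/-- **AT THE LARGEST ZERO EVERY MEMBER IS POSITIVE: `q_j(z_{m+1}) > 0` for all `j ≤ m + 1`** (no sign change is available, and a vanishing member would create one). [Gantmacher–Krein Ch. II
§1 Thm 6 (first eigenvector); Szegő Thm 3.3.4; this file, §1087] -/
theorem recurrence_eval_pos_at_top_zero {q : ℕ → ℝ[X]} {a b : ℕ → ℝ} (hq0 : q 0 = 1) (hq1 : q 1 = Polynomial.X - C (a 0))
    (hrec : ∀ n, q (n + 2) = (Polynomial.X - C (a (n + 1))) * q (n + 1) - C (b (n + 1)) * q n) (hb : ∀ j, 0 < b j)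
    {m : ℕ} {z : Fin (m + 2) → ℝ} (hz : StrictMono z) (hzq : q (m + 2) = ∏ k, (Polynomial.X - C (z k))) {j : ℕ} (hj : j ≤ m + 1) :
    0 < (q j).eval (z (Fin.last (m + 1))) := by
  have hzlast : (q (m + 2)).eval (z (Fin.last (m + 1))) = 0 := by
    rw [hzq, eval_prod]
    exact Finset.prod_eq_zero (Finset.mem_univ _) (by rw [eval_sub, eval_X, eval_C, sub_self])
  have htop : (q (m + 1)).eval (z (Fin.last (m + 1))) ≠ 0 := fun h => recurrence_no_common_root hq0 hq1 hrec hb (m + 1) h hzlast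
  -- give the sign `+` to the vanishing entries
  have hg : ∀ i, i ≤ m + 1 → (fun i => if (q i).eval (z (Fin.last (m + 1))) = 0 then (1 : ℝ) else (q i).eval (z (Fin.last (m + 1)))) i ≠ 0 := fun i _ => by
    by_cases h : (q i).eval (z (Fin.last (m + 1))) = 0
    · simp only [if_pos h]; exact one_ne_zero
    · simp only [if_neg h]; exact h
  have hsgn : ∀ i, i ≤ m + 1 → (q i).eval (z (Fin.last (m + 1))) ≠ 0 →
      0 < (q i).eval (z (Fin.last (m + 1))) * (fun i => if (q i).eval (z (Fin.last (m + 1))) = 0 then (1 : ℝ) else (q i).eval (z (Fin.last (m + 1)))) i :=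
    fun i _ h => by simp only [if_neg h]; exact mul_self_pos.2 h
  have hcount := jacobi_eigenvector_sign_changes hq0 hq1 hrec hb hz hzq (Fin.last (m + 1)) hg hsgn
  rw [Fin.val_last, Nat.sub_self, Finset.card_eq_zero, Finset.filter_eq_empty_iff] at hcount
  -- every (signed) entry is positive
  have hgpos : ∀ i, i ≤ m + 1 → 0 < (fun i => if (q i).eval (z (Fin.last (m + 1))) = 0 then (1 : ℝ) else (q i).eval (z (Fin.last (m + 1)))) i := by
    intro i
    induction i with
    | zero => intro _; simp only [hq0, eval_one, one_ne_zero, if_false]; exact one_pos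
    | succ i ihi =>
      intro hi
      have hprev := ihi (by omega)
      rcases lt_or_gt_of_ne (hg (i + 1) hi) with hneg | hpos
      · exact absurd (mul_neg_of_pos_of_neg hprev hneg) (hcount (Finset.mem_range.2 (by omega)))
      · exact hpos
  have hval : ∀ i, i ≤ m + 1 → (q i).eval (z (Fin.last (m + 1))) ≠ 0 → 0 < (q i).eval (z (Fin.last (m + 1))) := fun i hi h => by
    have := hgpos i hi
    simp only [if_neg h] at this
    exact this
  by_cases h0 : (q j).eval (z (Fin.last (m + 1))) = 0
  · exfalso
    rcases j with _ | j
    · rw [hq0, eval_one] at h0; exact one_ne_zero h0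
    have hjm : j + 1 ≤ m := by
      rcases Nat.lt_or_ge (j + 1) (m + 1) with hl | hl
      · omega
      · have hjm' : j = m := by omega
        subst hjm'
        exact absurd h0 htop
    have hlink := recurrence_link_neg hq0 hq1 hrec hb j h0
    have hjne : (q j).eval (z (Fin.last (m + 1))) ≠ 0 := fun h => recurrence_no_common_root hq0 hq1 hrec hb j h h0
    have hj2ne : (q (j + 2)).eval (z (Fin.last (m + 1))) ≠ 0 := fun h => by rw [h, mul_zero] at hlink; exact lt_irrefl 0 hlink
    exact absurd hlink (not_lt.2 (mul_pos (hval j (by omega) hjne) (hval (j + 2) (by omega) hj2ne)).le)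
  · exact hval j hj h0

end Summit.Ventures.HSemireg.Wedge.HankelOuter
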